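import Summits.QuantumFields.YangMills.Theorems.UnitScaleTiltProp7FlatSliceRegularity
import Summits.QuantumFields.YangMills.Theorems.UnitScaleTiltProp8FlatPropagatorSup
import Summits.QuantumFields.YangMills.Theorems.UnitScaleTiltProp8FlatMinimizerHLandau
import Summits.QuantumFields.YangMills.Theorems.UnitScaleTiltProp8FlatMinimizerH
import Summits.QuantumFields.YangMills.Theorems.UnitScaleTiltProp8FlatPropagatorGradGlobal
import HarnessLib

/-!
# Route `UnitScaleTilt`, crux K1 child «MinimiserStabilityRegPr» (stmt-QuantumFields-19200), registered stub `stub_prop7From14` (V3, skeleton v7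
# cc37a1787726) — lane B: **FLAT LANDAU-SLICE ELLIPTIC REGULARITY MODULO MULTIPLIERS AT THE d = 3 CARRIER**, with print's `H` ([Balaban1984PropagatorsI]
# (1.63) `H_k`, p1 g14's `FlatMinimizerH`) and the flat `G = Δ_1⁻¹` of [Balaban1984PropagatorsII] (2.19)/(2.90) (p1 g14's `FlatPropagatorSup`):
# `sup|A| ≤ C_G·sup|∂*∂A − Q*ω| + C_H·(sup|Q_{K−n}A| + C_G·sup|∂*∂A − Q*ω|)` for `R∂*A = 0` and EVERY coarse `ω`, ABSOLUTE constants

Cell `ym3-torus` ∕ fleet seat `ym-ust-19200-p3` (WIDTH-LEVER lane B of V3; HUMAN RULING D-0037, YM ladder rung R3).  `--supports stmt-QuantumFields-19200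
--as helper`.  Sequel of `UnitScaleTiltProp7FlatSliceRegularity` (the algebra on the slice, every `Domains D`; the one-level `Δ_a`-orthogonality of a
Landau, curl-minimal right inverse; the letter form `abs_le_of_slice_of_letters`).  THIS FILE discharges the letters at the carrier of
`T3Thm1Carrier.varProblem3 F n K` (fine torus `Site (F.P K) 0`, one level at `j = K − n`, lattice factor `L^{K−n} = η⁻¹`, weights `(L^{K−n})³` = [B5]
`a = 1`) BY NAME: `G`'s sup letter `FlatPropagatorSup.abs_GE_le_sup_T3` (ABSOLUTE `C_sup(3)`), print's `H` = `tV⁻¹(pullR(H_k·b̃))` with `Q_{K−n}H = 1`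
(`FlatMinimizerH.bondAvgIter_H_eq`), `R∂*H = 0` (`FlatMinimizerHLandau.RE_dsE_H_eq_zero_T3`), curl-minimality over the fibre
(`FlatMinimizerHLandau.curlAction_H_le_T3`) — hence `Δ_a`-orthogonal by the prequel — and the sup letter `FlatMinimizerH.abs_H_le` (ABSOLUTE `C_H(3)`).
* `abs_le_of_slice_of_avg_zero_T3` — homogeneous case (`Q_{K−n}A = 0`, no `H`): `|A(e)| ≤ C_sup(3)·sup|∂*∂A|` — the linear flat skeleton of
  [Balaban1985RegularSpaces] (1.36)/(1.136) first member ⇐ (1.9).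
* **`abs_le_of_slice_T3`** — `|A(e)| ≤ C_G·B + C_H·(β + C_G·B)` for `sup|∂*∂A − Q*ω| ≤ B`, `sup|Q_{K−n}A| ≤ β`, EVERY `ω`.
* **`exists_slice_sup_regularity_T3`** — packaged: one ABSOLUTE `C > 0` with `sup|A| ≤ C·(B + β)` for every member `F`, all `n, K`, every `ω`.
* **`exists_slice_grad_regularity_T3`** — the GRADIENT letter (second member of (1.136)/(165)): `L^{K−n}·|A(⟨s+e_ν,μ⟩) − A(⟨s,μ⟩)| ≤ C(L)·(B + β)`
  (`G`'s gradient letter `FlatPropagatorGradGlobal.exists_GE_sup_grad_lap_T3`, `C = C(L)`; `H`'s `FlatMinimizerH.abs_grad_H_le`, absolute).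
* §4 (appended) the CRITICAL-POINT letters: **`abs_le_of_critical_T3`**, `exists_critical_sup_regularity_T3`, `exists_critical_grad_regularity_T3` —
  print's (127) `⟨δ, ∂*∂A + r⟩ = 0 (Q_{K−n}δ = 0)` ⇒ `sup|A| ≤ C·(sup|r| + sup|Q_{K−n}A|)` and the gradient member.
HONEST SCOPE as in the prequel: linear, flat, one level, sup and gradient letters (the Laplacian letter of `H` is not in the tree); `Q*` = the `ℓ²`-adjoint of the straight block average (the port to the true
linearised (0.4)-constraint is the consumer's); nothing of the covariant chart V3-A.  No definition, no sorry, standard axioms.  NOT a claim about the mass gap.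

References: T. Bałaban, CMP **102** (1985) 277–309 [Balaban1985Variational] ((157)–(158) p.302, (165) p.303, (45)–(46) p.285); CMP **99** (1985) 75–102
[Balaban1985RegularSpaces] (Prop. 6, (1.136)–(1.138) p.99); CMP **95** (1984) 17–40 [Balaban1984PropagatorsI] ((1.63) p.28, (1.115) p.36).
-/

set_option autoImplicit false

noncomputable section

open scoped BigOperators InnerProductSpace Matrix ComplexConjugate

namespace Summit.QuantumFields.YangMills.Theorems.Prop7FlatSliceRegularity

open Literature.MathematicalPhysics.QuantumFieldTheory.Balaban1983to89
open Literature.MathematicalPhysics.QuantumFieldTheory.BalabanImbrieJaffe1984to88.BIJ85AxialPropagator411 (BondSpace PlaqSpace)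
open Literature.MathematicalPhysics.QuantumFieldTheory.BalabanImbrieJaffe1984to88.BIJ85GaugeFnBound513 (norm_bondAvgIter_le)
open LatticeFieldCalculus B6SectADomainsV1 B6SectAOperatorsV1 B6SectAVectorModelV1 B6SectCTwoScaleV1 B6GOneLevelV1Bridge

/-! ## §3 At the d = 3 carrier with print's `H` and the flat `G` of [B5]: absolute constants, uniform in `L`, in the volume, in `n` and in `K` -/

section T3

open T3ContinuumYM3Torus (T3Family)
open Prop7FlatCoercivityR (succ_le_T3)
open B5Eq117TorusCarriers (Mk tV tB)
open B5SectBStatements (cplx eta)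
open B5TowerOneStroke (pullR)
open B5Hk163Torus (HkOp)
open B5Hk163Decay (MG163 MG163_nonneg)
open B5Hk163Strip (kappa163 kappa163_pos)
open B5Hk163TorusHolderDecay (MD163 CHolder163_nonneg)
open B4TorusKernel (periodConst)
open B5Kernel166Decay (periodConst_pos)
open B4Sect5Proof (latticeConst latticeConst_nonneg)
open B5G183Strip (kappa183 kappa183_pos)
open B5G183CovDecay (MD183 MD183_nonneg)

/-- **HOMOGENEOUS CASE AT THE CARRIER** (no `H` needed): a real bond field on the fine torus of run `K` with print's flat Landau condition
`R∂*A = 0` (one-level structure at `j = K − n`, lattice factor `L^{K−n} = η⁻¹`, weights `(L^{K−n})³` = [B5] `a = 1`) AND vanishing `(K−n)`-fold block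
averages is bounded pointwise by its linearised current: `|A(e)| ≤ C_sup(3)·sup|∂*∂A|`, `C_sup(3)` ABSOLUTE (p1 g14's `FlatPropagatorSup.abs_GE_le_sup_T3`) —
the linear flat skeleton of [Balaban1985RegularSpaces] (1.36)/(1.136) first member ⇐ (1.9), in `η`-units.
[cite: Balaban1985RegularSpaces, Prop. 6 (1.136)-(1.138) p.99; Balaban1984PropagatorsI, (1.115) p.36] -/
theorem abs_le_of_slice_of_avg_zero_T3 (F : T3Family) (n K : ℕ)
    {w : BondIdx (twoScale (K - n) (succ_le_T3 F n K) (∅ : Finset (Site (F.P K) (K - n + 1)))) → ℝ}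
    (hw : ∀ i, 0 < w i) (hwa : ∀ p, w p = ((F.L : ℝ) ^ (K - n)) ^ 3)
    (x : BondSpace (F.P K))
    (hx : RE (twoScale (K - n) (succ_le_T3 F n K) (∅ : Finset (Site (F.P K) (K - n + 1)))) ((F.L : ℝ) ^ (K - n))
      (dsE ((F.L : ℝ) ^ (K - n)) x) = 0)
    (hQ : bondAvgIter (K - n) (WithLp.ofLp x) = 0) {B : ℝ}
    (hB : ∀ e, |(dcsE ((F.L : ℝ) ^ (K - n)) (dcE ((F.L : ℝ) ^ (K - n)) x)) e| ≤ B) (e : PBond (F.P K) 0) :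
    |x e| ≤ B * (16 * Real.exp (1 / 6) * latticeConst 3 (1 / 6)
          + 3 * (MD183 3 2 * periodConst (kappa183 3) 2 * latticeConst 3 (kappa183 3 / 3))) := by
  have hc : ((F.L : ℝ)) ^ (K - n) ≠ 0 := pow_ne_zero (K - n) (Nat.cast_ne_zero.2 (F.P K).L_pos.ne')
  have hQE : QE (twoScale (K - n) (succ_le_T3 F n K) (∅ : Finset (Site (F.P K) (K - n + 1)))) x = 0 :=
    (QE_twoScale_empty_eq_zero_iff (succ_le_T3 F n K) x).mpr hQ
  have hrep := eq_GE_of_slice_of_QE_eq_zero (twoScale (K - n) (succ_le_T3 F n K) ∅) hc hw hx hQE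
  have hxe : x e = GE (twoScale (K - n) (succ_le_T3 F n K) ∅) hc hw (dcsE ((F.L : ℝ) ^ (K - n)) (dcE ((F.L : ℝ) ^ (K - n)) x)) e :=
    congrArg (fun v : BondSpace (F.P K) => v e) hrep
  rw [hxe]
  exact FlatPropagatorSup.abs_GE_le_sup_T3 F n K hw hwa _ hB e

/-- `η^3 > 0` at the carrier (the weight of print's curl action). [cite: Balaban1984PropagatorsI, (1.3) p.18] -/
theorem eta_pow_pos (F : T3Family) (k : ℕ) : 0 < eta F.L k ^ 3 := by
  have hL : (0 : ℝ) < F.L := by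
    have := F.hL.2
    exact_mod_cast (by omega : 0 < F.L)
  unfold B5SectBStatements.eta
  exact pow_pos (inv_pos.mpr (pow_pos hL _)) 3

/-- **FLAT LANDAU-SLICE ELLIPTIC REGULARITY MODULO MULTIPLIERS AT THE d = 3 CARRIER, WITH PRINT'S `H`**: for every real bond field `A` on the fine
torus of run `K` with `R∂*A = 0` (the flat residual Landau condition of [Balaban1985Variational] (21)/(153), one level at `j = K − n`), EVERY coarse
field `ω` on the bonds of `T^{(K−n)}` (a candidate Lagrange multiplier of the averaging constraint), `sup|∂*∂A − Q*ω| ≤ B` and `sup|Q_{K−n}A| ≤ β`: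
`|A(e)| ≤ C_G·B + C_H·(β + C_G·B)` with the ABSOLUTE constants `C_G = C_sup(3)` of `FlatPropagatorSup.abs_GE_le_sup_T3` and `C_H = C_H(3)` of
`FlatMinimizerH.abs_H_le` — print's `H` (`Hb = tV⁻¹(pullR(H_k·b̃))`) being `Δ_a`-orthogonal by §2 from `bondAvgIter_H_eq`, `RE_dsE_H_eq_zero_T3`,
`curlAction_H_le_T3`.  Uniform in `L`, `m`, `n`, `K`.  (The linear core of «E–L current = multiplier current + small ⇒ sup-regularity of the constrained
minimiser», [Balaban1985Variational] (157)/(165), without the chart (47).) [cite: Balaban1985Variational, (157) p.302, (165) p.303, (45)-(46) p.285] -/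
theorem abs_le_of_slice_T3 (F : T3Family) (n K : ℕ)
    {w : BondIdx (twoScale (K - n) (succ_le_T3 F n K) (∅ : Finset (Site (F.P K) (K - n + 1)))) → ℝ}
    (hw : ∀ i, 0 < w i) (hwa : ∀ p, w p = ((F.L : ℝ) ^ (K - n)) ^ 3)
    (x : BondSpace (F.P K))
    (hx : RE (twoScale (K - n) (succ_le_T3 F n K) (∅ : Finset (Site (F.P K) (K - n + 1)))) ((F.L : ℝ) ^ (K - n))
      (dsE ((F.L : ℝ) ^ (K - n)) x) = 0)
    (ω : BondIdxSpace (twoScale (K - n) (succ_le_T3 F n K) (∅ : Finset (Site (F.P K) (K - n + 1))))) {B β : ℝ}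
    (hB : ∀ e, |(dcsE ((F.L : ℝ) ^ (K - n)) (dcE ((F.L : ℝ) ^ (K - n)) x)
      - QsE (twoScale (K - n) (succ_le_T3 F n K) (∅ : Finset (Site (F.P K) (K - n + 1)))) ω) e| ≤ B)
    (hβ : ∀ c', |bondAvgIter (K - n) (WithLp.ofLp x) c'| ≤ β) (e : PBond (F.P K) 0) :
    |x e| ≤ (16 * Real.exp (1 / 6) * latticeConst 3 (1 / 6) + 3 * (MD183 3 2 * periodConst (kappa183 3) 2 * latticeConst 3 (kappa183 3 / 3))) * B
      + MG163 3 * periodConst (kappa163 3) 2 * (3 * latticeConst 3 (kappa163 3 / 3))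
        * (β + (16 * Real.exp (1 / 6) * latticeConst 3 (1 / 6)
            + 3 * (MD183 3 2 * periodConst (kappa183 3) 2 * latticeConst 3 (kappa183 3 / 3))) * B) := by
  have hc : ((F.L : ℝ)) ^ (K - n) ≠ 0 := pow_ne_zero (K - n) (Nat.cast_ne_zero.2 (F.P K).L_pos.ne')
  have hj : K - n ≤ (F.P K).m + (F.P K).K := Nat.le_of_succ_le (succ_le_T3 F n K)
  refine abs_le_of_slice_of_letters (succ_le_T3 F n K) hc hw (eta_pow_pos F (K - n))
    (H := fun b => (tV hj).symm (pullR (F.P K).L (Mk (F.P K) (K - n)) (K - n)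
      (HkOp ((F.P K).L ^ (K - n)) (Mk (F.P K) (K - n)) *ᵥ cplx (tB b))))
    (fun b => FlatMinimizerH.bondAvgIter_H_eq hj b)
    (fun b => FlatMinimizerHLandau.RE_dsE_H_eq_zero_T3 F n K b)
    (fun b A hA => FlatMinimizerHLandau.curlAction_H_le_T3 F n K b A hA)
    (fun u B' hu e' => ?_) (fun b β' hb e' => ?_) x hx ω hB hβ e
  · rw [mul_comm]
    exact FlatPropagatorSup.abs_GE_le_sup_T3 F n K hw hwa u hu e'
  · have h := FlatMinimizerH.abs_H_le (P := F.P K) hj b hb e'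
    have hd : (F.P K).d = 3 := rfl
    simp only [hd] at h
    convert h using 2
    norm_num

/-- **PACKAGED**: one ABSOLUTE constant `C > 0` such that for every member `F` of the T³ family, all heights `n, K`, every real bond field `A` on the
fine torus of run `K` with `R∂*A = 0`, every coarse `ω` and all `B, β ≥ 0` with `sup|∂*∂A − Q*ω| ≤ B`, `sup|Q_{K−n}A| ≤ β`:
`sup|A| ≤ C·(B + β)`. [cite: Balaban1985Variational, (157) p.302, (165) p.303; Balaban1985RegularSpaces, (1.136)-(1.138) p.99] -/
theorem exists_slice_sup_regularity_T3 : ∃ C : ℝ, 0 < C ∧ ∀ (F : T3Family) (n K : ℕ)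
    (w : BondIdx (twoScale (K - n) (succ_le_T3 F n K) (∅ : Finset (Site (F.P K) (K - n + 1)))) → ℝ)
    (hw : ∀ i, 0 < w i), (∀ p, w p = ((F.L : ℝ) ^ (K - n)) ^ 3) →
    ∀ (x : BondSpace (F.P K)),
      RE (twoScale (K - n) (succ_le_T3 F n K) (∅ : Finset (Site (F.P K) (K - n + 1)))) ((F.L : ℝ) ^ (K - n))
        (dsE ((F.L : ℝ) ^ (K - n)) x) = 0 →
      ∀ (ω : BondIdxSpace (twoScale (K - n) (succ_le_T3 F n K) (∅ : Finset (Site (F.P K) (K - n + 1))))) (B β : ℝ),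
        0 ≤ B → 0 ≤ β →
        (∀ e, |(dcsE ((F.L : ℝ) ^ (K - n)) (dcE ((F.L : ℝ) ^ (K - n)) x)
          - QsE (twoScale (K - n) (succ_le_T3 F n K) (∅ : Finset (Site (F.P K) (K - n + 1)))) ω) e| ≤ B) →
        (∀ c', |bondAvgIter (K - n) (WithLp.ofLp x) c'| ≤ β) →
        ∀ e : PBond (F.P K) 0, |x e| ≤ C * (B + β) := by
  set CG : ℝ := 16 * Real.exp (1 / 6) * latticeConst 3 (1 / 6)
      + 3 * (MD183 3 2 * periodConst (kappa183 3) 2 * latticeConst 3 (kappa183 3 / 3)) with hCG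
  set CH : ℝ := MG163 3 * periodConst (kappa163 3) 2 * (3 * latticeConst 3 (kappa163 3 / 3)) with hCH
  have hCG0 : 0 ≤ CG := by
    have hK₁ : 0 ≤ latticeConst 3 (1 / 6) := latticeConst_nonneg _ (by norm_num)
    have hK₂ : 0 ≤ latticeConst 3 (kappa183 3 / 3) := latticeConst_nonneg _ (div_pos (kappa183_pos _) (by norm_num)).le
    have hM : 0 ≤ MD183 3 2 * periodConst (kappa183 3) 2 := mul_nonneg (MD183_nonneg _ _) (periodConst_pos (kappa183_pos _) _).le
    positivity
  have hCH0 : 0 ≤ CH := by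
    have hK : 0 ≤ latticeConst 3 (kappa163 3 / 3) := latticeConst_nonneg _ (div_pos (kappa163_pos _) (by norm_num)).le
    have hM : 0 ≤ MG163 3 * periodConst (kappa163 3) 2 := mul_nonneg (MG163_nonneg _) (periodConst_pos (kappa163_pos _) _).le
    rw [hCH, show MG163 3 * periodConst (kappa163 3) 2 * (3 * latticeConst 3 (kappa163 3 / 3))
      = (MG163 3 * periodConst (kappa163 3) 2) * (3 * latticeConst 3 (kappa163 3 / 3)) from rfl]
    positivity
  refine ⟨CG + CH * CG + CH + 1, by positivity, fun F n K w hw hwa x hx ω B β hB0 hβ0 hB hβ e => ?_⟩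
  have h := abs_le_of_slice_T3 F n K hw hwa x hx ω hB hβ e
  have h' : |x e| ≤ CG * B + CH * (β + CG * B) := h
  calc |x e| ≤ CG * B + CH * (β + CG * B) := h'
    _ = (CG + CH * CG) * B + CH * β := by ring
    _ ≤ (CG + CH * CG + CH + 1) * B + (CG + CH * CG + CH + 1) * β := by
        apply add_le_add
        · exact mul_le_mul_of_nonneg_right (by nlinarith) hB0
        · exact mul_le_mul_of_nonneg_right (by nlinarith) hβ0
    _ = (CG + CH * CG + CH + 1) * (B + β) := by ring

/-- **THE GRADIENT LETTER (second member of (1.136)/(165)) AT THE CARRIER**: for a block size `L` there is `C = C(L) > 0` such that for every member `F`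
with `F.L = L`, heights `n < K`, every real bond field `A` with `R∂*A = 0`, every coarse `ω`, `B, β ≥ 0` with `sup|∂*∂A − Q*ω| ≤ B`, `sup|Q_{K−n}A| ≤ β`:
`L^{K−n}·|A(⟨s+e_ν, μ⟩) − A(⟨s, μ⟩)| ≤ C·(B + β)` (η-units: `|∇^ηA| ≤ C(B + β)`), from the same representation with the gradient letters of `G`
(`FlatPropagatorGradGlobal.exists_GE_sup_grad_lap_T3`, `C(L)`) and of print's `H` (`FlatMinimizerH.abs_grad_H_le`, absolute).
[cite: Balaban1985Variational, (165) p.303, (46) p.285; Balaban1985RegularSpaces, (1.136) p.99] -/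
theorem exists_slice_grad_regularity_T3 (L : ℕ) (hL : Odd L ∧ 1 < L) : ∃ C : ℝ, 0 < C ∧ ∀ (F : T3Family), F.L = L → ∀ (n K : ℕ), n < K →
    ∀ (w : BondIdx (twoScale (K - n) (succ_le_T3 F n K) (∅ : Finset (Site (F.P K) (K - n + 1)))) → ℝ)
    (hw : ∀ i, 0 < w i), (∀ p, w p = ((F.L : ℝ) ^ (K - n)) ^ 3) →
    ∀ (x : BondSpace (F.P K)),
      RE (twoScale (K - n) (succ_le_T3 F n K) (∅ : Finset (Site (F.P K) (K - n + 1)))) ((F.L : ℝ) ^ (K - n))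
        (dsE ((F.L : ℝ) ^ (K - n)) x) = 0 →
      ∀ (ω : BondIdxSpace (twoScale (K - n) (succ_le_T3 F n K) (∅ : Finset (Site (F.P K) (K - n + 1))))) (B β : ℝ),
        0 ≤ B → 0 ≤ β →
        (∀ e, |(dcsE ((F.L : ℝ) ^ (K - n)) (dcE ((F.L : ℝ) ^ (K - n)) x)
          - QsE (twoScale (K - n) (succ_le_T3 F n K) (∅ : Finset (Site (F.P K) (K - n + 1)))) ω) e| ≤ B) →
        (∀ c', |bondAvgIter (K - n) (WithLp.ofLp x) c'| ≤ β) →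
        ∀ (s : Site (F.P K) 0) (μ ν : Fin 3), (F.L : ℝ) ^ (K - n) * |x ⟨s.shift ν, μ⟩ - x ⟨s, μ⟩| ≤ C * (B + β) := by
  obtain ⟨C₁, hC₁, hG⟩ := FlatPropagatorGradGlobal.exists_GE_sup_grad_lap_T3 L hL one_pos
  set CH : ℝ := MD163 3 * periodConst (kappa163 3) 2 * (3 * latticeConst 3 (kappa163 3 / 3)) with hCH
  have hCH0 : 0 ≤ CH := by
    have hK : 0 ≤ latticeConst 3 (kappa163 3 / 3) := latticeConst_nonneg _ (div_pos (kappa163_pos _) (by norm_num)).le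
    have hMD : 0 ≤ MD163 3 := by
      unfold MD163
      exact mul_nonneg (pow_nonneg (Real.exp_pos _).le _) (CHolder163_nonneg (0 : Fin 3) le_rfl one_pos)
    have hM : 0 ≤ MD163 3 * periodConst (kappa163 3) 2 := mul_nonneg hMD (periodConst_pos (kappa163_pos _) _).le
    rw [hCH, show MD163 3 * periodConst (kappa163 3) 2 * (3 * latticeConst 3 (kappa163 3 / 3))
      = (MD163 3 * periodConst (kappa163 3) 2) * (3 * latticeConst 3 (kappa163 3 / 3)) from rfl]
    positivity
  refine ⟨C₁ + CH * C₁ + CH + 1, by positivity, fun F hFL n K hnK w hw hwa x hx ω B β hB0 hβ0 hB hβ s μ ν => ?_⟩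
  have hc : ((F.L : ℝ)) ^ (K - n) ≠ 0 := pow_ne_zero (K - n) (Nat.cast_ne_zero.2 (F.P K).L_pos.ne')
  have hj : K - n ≤ (F.P K).m + (F.P K).K := Nat.le_of_succ_le (succ_le_T3 F n K)
  have hwa' : ∀ p, w p = 1 * ((F.L : ℝ) ^ (K - n)) ^ 3 := fun p => by rw [hwa, one_mul]
  -- the representation with print's `H`
  have hrep := eq_GE_add_H_of_slice (succ_le_T3 F n K) hc hw (eta_pow_pos F (K - n))
    (H := fun b => (tV hj).symm (pullR (F.P K).L (Mk (F.P K) (K - n)) (K - n)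
      (HkOp ((F.P K).L ^ (K - n)) (Mk (F.P K) (K - n)) *ᵥ cplx (tB b))))
    (fun b => FlatMinimizerH.bondAvgIter_H_eq hj b)
    (fun b => FlatMinimizerHLandau.RE_dsE_H_eq_zero_T3 F n K b)
    (fun b A hA => FlatMinimizerHLandau.curlAction_H_le_T3 F n K b A hA) x hx ω
  set u : BondSpace (F.P K) := dcsE ((F.L : ℝ) ^ (K - n)) (dcE ((F.L : ℝ) ^ (K - n)) x)
      - QsE (twoScale (K - n) (succ_le_T3 F n K) (∅ : Finset (Site (F.P K) (K - n + 1)))) ω with hu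
  obtain ⟨hGsup, hGgrad, -⟩ := hG F hFL n K hnK w hw hwa' u B hB
  set b' : VecField (F.P K) (K - n) ℝ := fun c' => bondAvgIter (K - n) (WithLp.ofLp x) c'
      - bondAvgIter (K - n) (WithLp.ofLp (GE (twoScale (K - n) (succ_le_T3 F n K) ∅) hc hw u)) c' with hb'
  have hdat : ∀ c', |b' c'| ≤ β + C₁ * B := fun c' =>
    (abs_sub _ _).trans (add_le_add (hβ c') (by
      have h := norm_bondAvgIter_le (K - n) (WithLp.ofLp (GE (twoScale (K - n) (succ_le_T3 F n K) ∅) hc hw u)) (a := C₁ * B)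
        (fun e => by rw [Real.norm_eq_abs]; exact hGsup e) c'
      rwa [Real.norm_eq_abs] at h))
  have hxe : ∀ e : PBond (F.P K) 0, x e = GE (twoScale (K - n) (succ_le_T3 F n K) ∅) hc hw u e
      + (tV hj).symm (pullR (F.P K).L (Mk (F.P K) (K - n)) (K - n)
          (HkOp ((F.P K).L ^ (K - n)) (Mk (F.P K) (K - n)) *ᵥ cplx (tB b'))) e := fun e => by
    have := congrArg (fun v : BondSpace (F.P K) => v e) hrep
    simpa using this
  -- the two gradient letters
  have hGd := hGgrad s μ ν
  have hHd : (F.L : ℝ) ^ (K - n) *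
      |(tV hj).symm (pullR (F.P K).L (Mk (F.P K) (K - n)) (K - n) (HkOp ((F.P K).L ^ (K - n)) (Mk (F.P K) (K - n)) *ᵥ cplx (tB b')))
          ⟨s.shift ν, μ⟩
        - (tV hj).symm (pullR (F.P K).L (Mk (F.P K) (K - n)) (K - n) (HkOp ((F.P K).L ^ (K - n)) (Mk (F.P K) (K - n)) *ᵥ cplx (tB b')))
          ⟨s, μ⟩| ≤ CH * (β + C₁ * B) := by
    have h := FlatMinimizerH.abs_grad_H_le (P := F.P K) hj b' hdat s μ ν
    have hd : (F.P K).d = 3 := rfl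
    simp only [hd] at h
    norm_num at h
    rw [hCH]
    exact h
  have hL0 : (0 : ℝ) ≤ (F.L : ℝ) ^ (K - n) := by positivity
  rw [hxe, hxe]
  have hsplit : ∀ (g₁ g₀ h₁ h₀ : ℝ), |g₁ + h₁ - (g₀ + h₀)| ≤ |g₁ - g₀| + |h₁ - h₀| := fun g₁ g₀ h₁ h₀ => by
    rw [show g₁ + h₁ - (g₀ + h₀) = (g₁ - g₀) + (h₁ - h₀) by ring]
    exact abs_add_le _ _
  calc (F.L : ℝ) ^ (K - n) * |_| ≤ (F.L : ℝ) ^ (K - n) * (|_| + |_|) := mul_le_mul_of_nonneg_left (hsplit _ _ _ _) hL0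
    _ = (F.L : ℝ) ^ (K - n) * |_| + (F.L : ℝ) ^ (K - n) * |_| := mul_add _ _ _
    _ ≤ C₁ * B + CH * (β + C₁ * B) := add_le_add hGd hHd
    _ = (C₁ + CH * C₁) * B + CH * β := by ring
    _ ≤ (C₁ + CH * C₁ + CH + 1) * B + (C₁ + CH * C₁ + CH + 1) * β := by
        apply add_le_add
        · exact mul_le_mul_of_nonneg_right (by nlinarith) hB0
        · exact mul_le_mul_of_nonneg_right (by nlinarith) hβ0
    _ = (C₁ + CH * C₁ + CH + 1) * (B + β) := by ring

end T3

/-! ## §4 The critical-point letters at the carrier (appended; lane B, seat ym-ust-19200-p3 g0): print's (127) ⇒ (133)–(136), linear flat skeleton -/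

section CriticalT3

open T3ContinuumYM3Torus (T3Family)
open Prop7FlatCoercivityR (succ_le_T3)
open B5Eq117TorusCarriers (Mk tV tB)
open B5SectBStatements (cplx eta)
open B5TowerOneStroke (pullR)
open B5Hk163Torus (HkOp)
open B5Hk163Decay (MG163 MG163_nonneg)
open B5Hk163Strip (kappa163 kappa163_pos)
open B4TorusKernel (periodConst)
open B5Kernel166Decay (periodConst_pos)
open B4Sect5Proof (latticeConst latticeConst_nonneg)
open B5G183Strip (kappa183 kappa183_pos)
open B5G183CovDecay (MD183 MD183_nonneg)

/-- **CRITICAL SLICE FIELDS AT THE d = 3 CARRIER**: for a real bond field `A` on the fine torus of run `K` with `R∂*A = 0` whose linearised current plus a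
remainder `r` is orthogonal to the kernel of the `(K−n)`-fold block average (print's (127): `⟨δ, ∂*∂A + r⟩ = 0` for `Q_{K−n}δ = 0` — the Euler–Lagrange
equation in the Landau slice with everything nonlinear collected in `r`), `sup|r| ≤ B`, `sup|Q_{K−n}A| ≤ β`:
`|A(e)| ≤ C_G·B + C_H·(β + C_G·B)` with the ABSOLUTE constants of `abs_le_of_slice_T3` — the sup norm of a critical slice field is controlled by the
nonlinear remainder of its current and its constraint datum only ((133) `A − H₀(QA) = −G̃(…)` ⇒ (136)). [cite: Balaban1985Variational, (127) p.297, (133)-(136) p.298] -/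
theorem abs_le_of_critical_T3 (F : T3Family) (n K : ℕ)
    {w : BondIdx (twoScale (K - n) (succ_le_T3 F n K) (∅ : Finset (Site (F.P K) (K - n + 1)))) → ℝ}
    (hw : ∀ i, 0 < w i) (hwa : ∀ p, w p = ((F.L : ℝ) ^ (K - n)) ^ 3)
    (x r : BondSpace (F.P K))
    (hx : RE (twoScale (K - n) (succ_le_T3 F n K) (∅ : Finset (Site (F.P K) (K - n + 1)))) ((F.L : ℝ) ^ (K - n))
      (dsE ((F.L : ℝ) ^ (K - n)) x) = 0)
    (hcrit : ∀ δ, QE (twoScale (K - n) (succ_le_T3 F n K) (∅ : Finset (Site (F.P K) (K - n + 1)))) δ = 0 →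
      ⟪δ, dcsE ((F.L : ℝ) ^ (K - n)) (dcE ((F.L : ℝ) ^ (K - n)) x) + r⟫_ℝ = 0)
    {B β : ℝ} (hB : ∀ e, |r e| ≤ B) (hβ : ∀ c', |bondAvgIter (K - n) (WithLp.ofLp x) c'| ≤ β) (e : PBond (F.P K) 0) :
    |x e| ≤ (16 * Real.exp (1 / 6) * latticeConst 3 (1 / 6) + 3 * (MD183 3 2 * periodConst (kappa183 3) 2 * latticeConst 3 (kappa183 3 / 3))) * B
      + MG163 3 * periodConst (kappa163 3) 2 * (3 * latticeConst 3 (kappa163 3 / 3))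
        * (β + (16 * Real.exp (1 / 6) * latticeConst 3 (1 / 6)
            + 3 * (MD183 3 2 * periodConst (kappa183 3) 2 * latticeConst 3 (kappa183 3 / 3))) * B) := by
  obtain ⟨ω, hω⟩ := exists_QsE_eq_of_orth_ker (twoScale (K - n) (succ_le_T3 F n K) ∅) hcrit
  have hr : dcsE ((F.L : ℝ) ^ (K - n)) (dcE ((F.L : ℝ) ^ (K - n)) x)
      - QsE (twoScale (K - n) (succ_le_T3 F n K) (∅ : Finset (Site (F.P K) (K - n + 1)))) ω = -r := by
    rw [hω]; abel
  refine abs_le_of_slice_T3 F n K hw hwa x hx ω (B := B) (fun e' => ?_) hβ e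
  rw [hr, PiLp.neg_apply, abs_neg]
  exact hB e'

/-- **PACKAGED**: one ABSOLUTE `C > 0` such that for every member `F`, all heights `n, K`, every real bond field `A` with `R∂*A = 0` that is critical in the
sense of (127) with remainder `r`, and all `B, β ≥ 0` with `sup|r| ≤ B`, `sup|Q_{K−n}A| ≤ β`: `sup|A| ≤ C·(B + β)`.
[cite: Balaban1985Variational, (127) p.297, (133)-(136) p.298, (165) p.303] -/
theorem exists_critical_sup_regularity_T3 : ∃ C : ℝ, 0 < C ∧ ∀ (F : T3Family) (n K : ℕ)
    (w : BondIdx (twoScale (K - n) (succ_le_T3 F n K) (∅ : Finset (Site (F.P K) (K - n + 1)))) → ℝ)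
    (hw : ∀ i, 0 < w i), (∀ p, w p = ((F.L : ℝ) ^ (K - n)) ^ 3) →
    ∀ (x r : BondSpace (F.P K)),
      RE (twoScale (K - n) (succ_le_T3 F n K) (∅ : Finset (Site (F.P K) (K - n + 1)))) ((F.L : ℝ) ^ (K - n))
        (dsE ((F.L : ℝ) ^ (K - n)) x) = 0 →
      (∀ δ, QE (twoScale (K - n) (succ_le_T3 F n K) (∅ : Finset (Site (F.P K) (K - n + 1)))) δ = 0 →
        ⟪δ, dcsE ((F.L : ℝ) ^ (K - n)) (dcE ((F.L : ℝ) ^ (K - n)) x) + r⟫_ℝ = 0) →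
      ∀ (B β : ℝ), 0 ≤ B → 0 ≤ β → (∀ e, |r e| ≤ B) → (∀ c', |bondAvgIter (K - n) (WithLp.ofLp x) c'| ≤ β) →
        ∀ e : PBond (F.P K) 0, |x e| ≤ C * (B + β) := by
  obtain ⟨C, hC, h⟩ := exists_slice_sup_regularity_T3
  refine ⟨C, hC, fun F n K w hw hwa x r hx hcrit B β hB0 hβ0 hB hβ e => ?_⟩
  obtain ⟨ω, hω⟩ := exists_QsE_eq_of_orth_ker (twoScale (K - n) (succ_le_T3 F n K) ∅) hcrit
  have hr : dcsE ((F.L : ℝ) ^ (K - n)) (dcE ((F.L : ℝ) ^ (K - n)) x)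
      - QsE (twoScale (K - n) (succ_le_T3 F n K) (∅ : Finset (Site (F.P K) (K - n + 1)))) ω = -r := by
    rw [hω]; abel
  refine h F n K w hw hwa x hx ω B β hB0 hβ0 (fun e' => ?_) hβ e
  rw [hr, PiLp.neg_apply, abs_neg]
  exact hB e'

/-- **PACKAGED, GRADIENT MEMBER** (`C = C(L)`): `L^{K−n}·|A(⟨s+e_ν,μ⟩) − A(⟨s,μ⟩)| ≤ C·(B + β)` for critical slice fields as above.
[cite: Balaban1985Variational, (133)-(136) p.298, (165) p.303] -/
theorem exists_critical_grad_regularity_T3 (L : ℕ) (hL : Odd L ∧ 1 < L) : ∃ C : ℝ, 0 < C ∧ ∀ (F : T3Family), F.L = L → ∀ (n K : ℕ), n < K →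
    ∀ (w : BondIdx (twoScale (K - n) (succ_le_T3 F n K) (∅ : Finset (Site (F.P K) (K - n + 1)))) → ℝ)
    (hw : ∀ i, 0 < w i), (∀ p, w p = ((F.L : ℝ) ^ (K - n)) ^ 3) →
    ∀ (x r : BondSpace (F.P K)),
      RE (twoScale (K - n) (succ_le_T3 F n K) (∅ : Finset (Site (F.P K) (K - n + 1)))) ((F.L : ℝ) ^ (K - n))
        (dsE ((F.L : ℝ) ^ (K - n)) x) = 0 →
      (∀ δ, QE (twoScale (K - n) (succ_le_T3 F n K) (∅ : Finset (Site (F.P K) (K - n + 1)))) δ = 0 →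
        ⟪δ, dcsE ((F.L : ℝ) ^ (K - n)) (dcE ((F.L : ℝ) ^ (K - n)) x) + r⟫_ℝ = 0) →
      ∀ (B β : ℝ), 0 ≤ B → 0 ≤ β → (∀ e, |r e| ≤ B) → (∀ c', |bondAvgIter (K - n) (WithLp.ofLp x) c'| ≤ β) →
        ∀ (s : Site (F.P K) 0) (μ ν : Fin 3), (F.L : ℝ) ^ (K - n) * |x ⟨s.shift ν, μ⟩ - x ⟨s, μ⟩| ≤ C * (B + β) := by
  obtain ⟨C, hC, h⟩ := exists_slice_grad_regularity_T3 L hL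
  refine ⟨C, hC, fun F hFL n K hnK w hw hwa x r hx hcrit B β hB0 hβ0 hB hβ s μ ν => ?_⟩
  obtain ⟨ω, hω⟩ := exists_QsE_eq_of_orth_ker (twoScale (K - n) (succ_le_T3 F n K) ∅) hcrit
  have hr : dcsE ((F.L : ℝ) ^ (K - n)) (dcE ((F.L : ℝ) ^ (K - n)) x)
      - QsE (twoScale (K - n) (succ_le_T3 F n K) (∅ : Finset (Site (F.P K) (K - n + 1)))) ω = -r := by
    rw [hω]; abel
  refine h F hFL n K hnK w hw hwa x hx ω B β hB0 hβ0 (fun e' => ?_) hβ s μ ν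
  rw [hr, PiLp.neg_apply, abs_neg]
  exact hB e'

end CriticalT3

end Summit.QuantumFields.YangMills.Theorems.Prop7FlatSliceRegularity

end
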